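import Summits.CriticalPhenomena.CardyFormulaZ2.Theorems.CardySelfRefinementLagHandOffNoIdle
import HarnessLib

/-!
# Limit-curve regularity of bond-`ℤ²` interface sublimits (line `hitting-tournament` of crux
`LagHandOff`, stmt-CriticalPhenomena-10268): the three conjuncts together

The registered stub `stub_limitCurveRegularity` of the line (cycle-1 form, namespace
`Summit.CriticalPhenomena.CardyFormulaZ2.Cruxes.LagHandOff.HittingTournament`) — Aizenman–Burchard /
Kemppainen–Smirnov **regularity of subsequential interface limits** for critical bond percolation on
`ℤ²`: along positive meshes `δₙ → 0`, every weak limit `ν` of the laws of the exploration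
interfaces of an admissible `ℤ²`-discretisation family of a Dobrushin domain `(D; a, b)` is carried by
curve classes that are (1) chordal in `D̄` from `a` to `b`, (2) trace no boundary arc, and (3) have
no representative idling inside its past range — is now a THEOREM: the conjunction of the landed
conjuncts `stub_limitCurveRegularity_chordal_noTrace` (p77447 + p82328: one-arm bound in boundary
annuli + portmanteau) and `stub_limitCurveRegularity_noIdle` (p98236: first-moment four-arm argument
with Garban's multi-scale bound `QuadCrossing.fourArm_bound`).

References: M. Aizenman, A. Burchard, Duke Math. J. 99 (1999), Thms 1.1–1.2; A. Kemppainen,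
S. Smirnov, Ann. Probab. 45 (2017), Thm 1.5 and §3.3 (the bond-`ℤ²` interface).
-/

noncomputable section

open MeasureTheory Filter Set Topology
open scoped unitInterval BoundedContinuousFunction
open Literature.Probability.Percolation Literature.Probability.LatticeModels
open Literature.Probability.RandomPlanarGeometry Literature.Probability.Percolation.QuadCrossing

namespace Summit.CriticalPhenomena.CardyFormulaZ2.Cruxes.LagHandOff.HittingTournament

/-- **Regularity of subsequential interface limits (AB99 / KS17 on `ℤ²`).** Along positive meshes
`δₙ → 0`, every weak limit `ν` of the interface laws of an admissible `ℤ²`-discretisation family of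
the Dobrushin domain `(D; a, b)` is carried by curve classes `γ` with: `γ` runs from `a = D.pt 0` to
`b = D.pt 1` inside `closure D`; every representative piece lying on `frontier D` is a point (no
boundary tracing); and on every parameter interval a representative is constant or visits a point
off its past range (no idling). Conjunction of the landed `stub_limitCurveRegularity_chordal_noTrace`
and `stub_limitCurveRegularity_noIdle`. -/
theorem stub_limitCurveRegularity :
    ∀ (D : DobrushinDomain) (E : ℝ → DiscreteDobrushin), ZdDiscretisationFamily D E →
      ∀ δs : ℕ → ℝ, (∀ n, 0 < δs n) → Tendsto δs atTop (𝓝 0) →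
        ∀ (ν : Measure (CurveClass ℂ)) [IsProbabilityMeasure ν],
          (∀ f : CurveClass ℂ →ᵇ ℝ,
            Tendsto (fun n => ∫ ω, f (bondInterfaceIn D (E (δs n)) ω)
              ∂(bondPercolation (zdGraph 2) half)) atTop (𝓝 (∫ γ, f γ ∂ν))) →
          ∀ᵐ γ ∂ν, (γ.source = D.pt 0 ∧ γ.target = D.pt 1 ∧ γ.range ⊆ closure D.carrier) ∧
            (∀ c : Curve ℂ, CurveClass.mk c = γ → ∀ s t : I, s < t →
              c '' Set.Icc s t ⊆ frontier D.carrier → (c '' Set.Icc s t).Subsingleton) ∧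
            (∀ c : Curve ℂ, CurveClass.mk c = γ → ∀ s t : I, s < t →
              (∀ u ∈ Set.Icc s t, c u = c s) ∨ ∃ u ∈ Set.Ioo s t, c u ∉ c '' Set.Icc 0 s) := by
  intro D E hE δs hpos hlim ν _ hconv
  filter_upwards [stub_limitCurveRegularity_chordal_noTrace D E hE δs hpos hlim ν hconv,
    stub_limitCurveRegularity_noIdle D E hE δs hpos hlim ν hconv] with γ h12 h3
  exact ⟨h12.1, h12.2, h3⟩

end Summit.CriticalPhenomena.CardyFormulaZ2.Cruxes.LagHandOff.HittingTournament

end
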